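import Mathlib
import HarnessLib
import Summits.NavierStokesRegularity.NavierStokesRegularity.Theorems.TaylorModelRungThreeCertificateIntervalDJetsDiff

/-!
# Crux K1b-DR (stmt-NavierStokesRegularity-23954), line `taylor-model` — certificate SOUNDNESS tooling: INTERVAL JETS, part 5 —
# the SECOND-ORDER remainder `R2_k = T (y+d) k − T y k − U y d k` of the jets in the displacement (VECTOR-LEMMAS-23954 §2 (D1),
# CERT-CONTRACT-23954-v3 §3 C2; the `Dev` replacement of the Lohner transport clause)

The Lohner form of the step transports the LINEAR part of the dependence on the start displacement `d` exactly (`Vap(h)·d`, from the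
exact variational jets `U y d k`) and encloses only the second-order remainder
`R2_k(y,d) := T (y+d) k − T y k − U y d k`. With `D_i := T (y+d) i − T y i` (part 3) and S1's recursions (`Q` additive in each slot),
re-indexing `Σ_{i≤k} Q (U_{k-i}) (T_i) = Σ_{i≤k} Q (U_i) (T_{k-i})` gives
`(k+1)·R2_{k+1} = Σ_{i≤k} [Q (T y i) R2_{k-i} + Q R2_i (T y (k-i)) + Q D_i D_{k-i}]`, `R2_0 = 0`,
whose rounded interval evaluation along the state levels `J` and the difference levels `JD` is `r2Step QB prec J JD JR k c`;
`IsR2Enclosure` (containment of the step in the next level, level `0 ∋ 0`) and `mem_r2_of_isR2Enclosure`: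
`rd (T y' k) c − rd (T y k) c − rd (U y (y'−y) k) c ∈ JR k c` for all `k ≤ K`, given `rd y ∈ J 0` and `rd (y'−y) ∈ JD 0`.

MODEL-lattice bookkeeping only (rung TL-M3, one finite-dimensional model ODE); nothing here concerns the Navier–Stokes equations.
-/

-- the sub-problem namespace repeats the summit name by design (D-0017)
set_option linter.dupNamespace false

namespace Summit.NavierStokesRegularity.NavierStokesRegularity.Theorems.TaylorModelCert

open scoped BigOperators

namespace IntervalD

section R2

variable {V : Type*} [AddCommGroup V] {σ : Type*} (rd : V → σ → ℝ) (Q : V → V → V) {T : V → ℕ → V} {U : V → V → ℕ → V}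

/-- The rounded interval evaluation of the SECOND-ORDER REMAINDER recursion: level `k+1`, coordinate `c`, from the state levels `J`,
the difference levels `JD` and the remainder levels `0..k` of `JR`:
`(Σ_{m≤k} (QB (J m) (JR (k-m)) c + QB (JR m) (J (k-m)) c + QB (JD m) (JD (k-m)) c)) / (k+1)`. [folklore] -/
def r2Step (QB : (σ → IntervalD) → (σ → IntervalD) → σ → IntervalD) (prec : ℕ) (J JD JR : ℕ → σ → IntervalD) (k : ℕ)
    (c : σ) : IntervalD :=
  divNat prec (rangeSumR prec (fun m =>
    addR prec (addR prec (QB (J m) (JR (k - m)) c) (QB (JR m) (J (k - m)) c)) (QB (JD m) (JD (k - m)) c)) (k + 1)) (k + 1)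

/-- `JR` is a SECOND-ORDER-REMAINDER ENCLOSURE up to order `K` along `J`, `JD`: level `0` contains `0` and each level `k+1 ≤ K`
contains the rounded interval evaluation of the remainder recursion. [folklore] -/
def IsR2Enclosure (QB : (σ → IntervalD) → (σ → IntervalD) → σ → IntervalD) (prec K : ℕ) (J JD JR : ℕ → σ → IntervalD) :
    Prop :=
  (∀ c, mem (0 : ℝ) (JR 0 c)) ∧ ∀ k < K, ∀ (c : σ) (x : ℝ), mem x (r2Step QB prec J JD JR k c) → mem x (JR (k + 1) c)

variable {rd Q}

/-- **The interval extension of the remainder recursion encloses the second-order remainders**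
`rd (T y' k) c − rd (T y k) c − rd (U y (y' − y) k) c ∈ JR k c` (`k ≤ K`), for `Q` additive in each slot, an additive reader `rd`,
S1's recursions for `T` and `U`, an interval extension `QB`, a jet enclosure `J` of the base point `y`, a jet-difference enclosure `JD`
for the displacement `y' − y`, and a remainder enclosure `JR` along them. [folklore; cite: Moore 1966 Ch. 3 (inclusion property)] -/
theorem mem_r2_of_isR2Enclosure (hQl : ∀ a d b, Q (a + d) b = Q a b + Q d b)
    (hQr : ∀ a b e, Q a (b + e) = Q a b + Q a e) (hrd : ∀ x z c, rd (x + z) c = rd x c + rd z c)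
    (hT0 : ∀ x c, rd (T x 0) c = rd x c)
    (hTs : ∀ x (k : ℕ) c, ((k : ℝ) + 1) * rd (T x (k + 1)) c =
      ∑ i ∈ Finset.range (k + 1), rd (Q (T x i) (T x (k - i))) c)
    (hU0 : ∀ x v c, rd (U x v 0) c = rd v c)
    (hUs : ∀ x v (k : ℕ) c, ((k : ℝ) + 1) * rd (U x v (k + 1)) c =
      ∑ i ∈ Finset.range (k + 1), (rd (Q (T x i) (U x v (k - i))) c + rd (Q (U x v (k - i)) (T x i)) c))
    {QB : (σ → IntervalD) → (σ → IntervalD) → σ → IntervalD} (hQB : IsFieldEnclosure rd Q QB)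
    {prec K : ℕ} {J JD JR : ℕ → σ → IntervalD} (hJ : IsJetEnclosure QB prec K J) (hJD : IsDiffJetEnclosure QB prec K J JD)
    (hJR : IsR2Enclosure QB prec K J JD JR)
    {y y' : V} (hy : ∀ c, mem (rd y c) (J 0 c)) (hd : ∀ c, mem (rd y' c - rd y c) (JD 0 c)) :
    ∀ k ≤ K, ∀ c, mem (rd (T y' k) c - rd (T y k) c - rd (U y (y' - y) k) c) (JR k c) := by
  have hT := mem_jet_of_isJetEnclosure hT0 hTs hQB hJ hy
  have hD := mem_diffJet_of_isDiffJetEnclosure hQl hQr hrd hT0 hTs hQB hJ hJD hy hd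
  have hsub : ∀ x z c, rd (x - z) c = rd x c - rd z c := fun x z c => by
    have h := hrd (x - z) z c; rw [sub_add_cancel] at h; linarith
  set d := y' - y with hdd
  intro k
  induction k using Nat.strong_induction_on with
  | _ k ih =>
    intro hk c
    cases k with
    | zero =>
      rw [hT0, hT0, hU0, hdd, hsub, sub_self]
      exact hJR.1 c
    | succ k =>
      -- remainders as states: `R m := T y' m - T y m - U y d m`
      have hlev : ∀ m ≤ k, ∀ c, mem (rd (T y' m - T y m - U y d m) c) (JR m c) := fun m hm c => by
        rw [hsub, hsub]; exact ih m (Nat.lt_succ_of_le hm) (le_trans (Nat.le_succ_of_le hm) hk) c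
      have hDm : ∀ m ≤ K, ∀ c, mem (rd (T y' m - T y m) c) (JD m c) := fun m hm c => by
        rw [hsub]; exact hD m hm c
      -- termwise algebra: with `D_i = U_i + R_i`,
      -- `Q(T'_i,T'_{k-i}) − Q(T_i,T_{k-i}) − [Q(T_i,U_{k-i}) + Q(U_i,T_{k-i})] = Q(T_i,R_{k-i}) + Q(R_i,T_{k-i}) + Q(D_i,D_{k-i})`
      have hterm : ∀ i, rd (Q (T y' i) (T y' (k - i))) c - rd (Q (T y i) (T y (k - i))) c -
          (rd (Q (T y i) (U y d (k - i))) c + rd (Q (U y d i) (T y (k - i))) c) =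
          rd (Q (T y i) (T y' (k - i) - T y (k - i) - U y d (k - i))) c +
            rd (Q (T y' i - T y i - U y d i) (T y (k - i))) c +
            rd (Q (T y' i - T y i) (T y' (k - i) - T y (k - i))) c := by
        intro i
        have e1 : T y' i = T y i + (T y' i - T y i) := by abel
        have e2 : T y' (k - i) = T y (k - i) + (T y' (k - i) - T y (k - i)) := by abel
        have e3 : T y' (k - i) - T y (k - i) = U y d (k - i) + (T y' (k - i) - T y (k - i) - U y d (k - i)) := by abel
        have e4 : T y' i - T y i = U y d i + (T y' i - T y i - U y d i) := by abel
        have hA : rd (Q (T y' i) (T y' (k - i))) c = rd (Q (T y i) (T y (k - i))) c +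
            rd (Q (T y i) (T y' (k - i) - T y (k - i))) c + rd (Q (T y' i - T y i) (T y (k - i))) c +
            rd (Q (T y' i - T y i) (T y' (k - i) - T y (k - i))) c := by
          conv_lhs => rw [e1, e2]
          rw [hQl, hQr, hQr, hrd, hrd, hrd]; ring
        have hB : rd (Q (T y i) (T y' (k - i) - T y (k - i))) c =
            rd (Q (T y i) (U y d (k - i))) c + rd (Q (T y i) (T y' (k - i) - T y (k - i) - U y d (k - i))) c := by
          conv_lhs => rw [e3]
          rw [hQr, hrd]
        have hC : rd (Q (T y' i - T y i) (T y (k - i))) c =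
            rd (Q (U y d i) (T y (k - i))) c + rd (Q (T y' i - T y i - U y d i) (T y (k - i))) c := by
          conv_lhs => rw [e4]
          rw [hQl, hrd]
        rw [hA, hB, hC]; ring
      -- the `U`-recursion with the mixed term re-indexed: `Σ_i Q(U_{k-i},T_i) = Σ_i Q(U_i,T_{k-i})`
      have hUsum : ((k : ℝ) + 1) * rd (U y d (k + 1)) c =
          ∑ i ∈ Finset.range (k + 1), (rd (Q (T y i) (U y d (k - i))) c + rd (Q (U y d i) (T y (k - i))) c) := by
        rw [hUs, Finset.sum_add_distrib, Finset.sum_add_distrib]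
        congr 1
        rw [← Finset.sum_range_reflect]
        refine Finset.sum_congr rfl fun i hi => ?_
        have hik : i ≤ k := Nat.lt_succ_iff.1 (Finset.mem_range.1 hi)
        rw [show k + 1 - 1 - i = k - i from by omega, show k - (k - i) = i from by omega]
      have hrec : rd (T y' (k + 1)) c - rd (T y (k + 1)) c - rd (U y d (k + 1)) c = (∑ i ∈ Finset.range (k + 1),
          (rd (Q (T y i) (T y' (k - i) - T y (k - i) - U y d (k - i))) c +
            rd (Q (T y' i - T y i - U y d i) (T y (k - i))) c +
            rd (Q (T y' i - T y i) (T y' (k - i) - T y (k - i))) c)) / ((k + 1 : ℕ) : ℝ) := by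
        rw [eq_div_iff (by positivity), ← Finset.sum_congr rfl fun i _ => hterm i, Finset.sum_sub_distrib,
          Finset.sum_sub_distrib, ← hTs y' k c, ← hTs y k c, ← hUsum]
        push_cast; ring
      rw [hrec]
      refine hJR.2 k (Nat.lt_of_succ_le hk) c _ ?_
      refine mem_divNat prec (mem_rangeSumR prec (k + 1) fun m hm => ?_) (Nat.succ_pos k)
      have hKm : m ≤ K := le_trans (Nat.le_of_lt_succ hm) ((Nat.le_succ k).trans hk)
      have hKkm : k - m ≤ K := le_trans (Nat.sub_le k m) ((Nat.le_succ k).trans hk)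
      exact mem_addR prec (mem_addR prec (hQB _ _ _ _ (hT m hKm) (hlev (k - m) (Nat.sub_le k m)) c)
        (hQB _ _ _ _ (hlev m (Nat.le_of_lt_succ hm)) (hT (k - m) hKkm) c))
        (hQB _ _ _ _ (hDm m hKm) (hDm (k - m) hKkm) c)

end R2

end IntervalD

end Summit.NavierStokesRegularity.NavierStokesRegularity.Theorems.TaylorModelCert
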